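import Mathlib.Analysis.Analytic.Order
import Mathlib.Analysis.Calculus.IteratedDeriv.Defs
import Mathlib.Analysis.Complex.Basic
import Mathlib.Algebra.BigOperators.Group.Finset.Basic
import Mathlib.Tactic.IntervalCases
import Mathlib.Tactic.LinearCombination
import HarnessLib

/-!
# Central order of vanishing forced by structure: sign, ladder, multiplicity

Topic `NumberTheory/LFunctions`. The elementary complex-analytic mechanisms by which the order of
vanishing of an `L`-function at the centre of its functional equation is FORCED by structure (as
opposed to measured numerically) — the common core of the "provable central order" column of a
census of Goldfeld-type inputs (Goldfeld 1976; Gross–Zagier 1986, I.§7–8; Iwaniec–Kowalski §5):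

* (M1) **parity from a self-dual functional equation** `Λ(c - s) = w · Λ(s)`: if `Λ` is analytic
  at the centre `a` (`a + a = c`) with finite order `n` there, then `w = (-1)ⁿ`
  (`CentralOrder.sign_eq_neg_one_pow`; `even_analyticOrderNatAt_iff`, `odd_analyticOrderNatAt_iff`).
  Dokchitser 2013, §1.1: "One immediate consequence of the two conjectures above is [the Parity
  Conjecture]". The weight-`2`, centre-`1` case is the tree's
  `Literature.Barriers.BirchSwinnertonDyer.sign_eq_neg_one_pow`, of which this is the general-centre
  form (Dedekind zeta / Artin `L`-functions: `c = 1`, `a = 1/2`; weight-`2` newforms: `c = 2`,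
  `a = 1`; weight-`2` triple products: `c = 4`, `a = 2`).
* (M2) **forced central zero**: `w ≠ 1` forces `Λ(a) = 0`, with no analyticity
  (`CentralOrder.apply_center_eq_zero_of_sign_ne_one`) — the root-number mechanism
  (`w(E) = -1 ⇒ L(E, 1) = 0`; `W(ρ) = -1` for a symplectic Artin representation `⇒ L(ρ, 1/2) = 0`,
  Fröhlich 1972).
* (M4) **the parity ladder**: if the first `n` Taylor coefficients at the centre vanish and
  `(-1)ⁿ ≠ w`, so does the `n`-th (`CentralOrder.succ_le_analyticOrderAt_of_neg_one_pow_ne`,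
  `CentralOrder.iteratedDeriv_eq_zero_of_neg_one_pow_ne`); in particular `w = 1 ∧ Λ(a) = 0 ⇒ ord ≥ 2`
  and `w = -1 ∧ Λ'(a) = 0 ⇒ ord ≥ 3` (`CentralOrder.two_le_analyticOrderAt`,
  `CentralOrder.three_le_analyticOrderAt`) — the shapes of the `389a` certificate (exact
  `L(E,1) = 0`, sign `+1`) and of the `5077a` certificate (`L'(E,1) = 0` exactly by Gross–Zagier,
  sign `-1`, hence `ord ≥ 3`: Gross–Zagier 1986, p. 231; Buhler–Gross–Zagier 1985, p. 479).
* (M3) **multiplicity / additivity under factorisation**: `ord ∏ᵢ fᵢ ^ mᵢ = ∑ᵢ mᵢ · ord fᵢ` for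
  factors analytic at the point (`CentralOrder.analyticOrderAt_finset_prod(_pow)`; Mathlib has the
  binary `analyticOrderAt_mul`, `analyticOrderAt_pow`), so every vanishing factor contributes its
  full multiplicity (`CentralOrder.sum_le_analyticOrderAt_finset_prod_pow`) — the mechanism of
  `ord L(E/K, s) = ord L(E, s) + ord L(E^{(d)}, s)` (tree: `analyticRankEK_eq_add_of`), of the Artin
  factorisation `ζ_L(s) = ∏_ρ L(ρ, s)^{dim ρ}` (two symplectic constituents of dimension `2` and root
  number `-1` force `ord_{s=1/2} ζ_L ≥ 4`), and of `L(E/F, s)` for dihedral `F`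
  (Kellock–Dokchitser 2023, Prop. 3.54: `ord ≥ n` for `Gal(F/ℚ) = D_{2n}`, Heegner hypothesis).
* (M1 + M3): `∑_{i ∈ S} mᵢ ≤ ord_{s=a} ∏ᵢ fᵢ ^ mᵢ` when the factors indexed by `S` have functional
  equations of sign `≠ 1` with centre `a` (`CentralOrder.sum_le_analyticOrderAt_finset_prod_pow_of_sign`,
  and `…_of_eventuallyEq_mul_finset_prod_pow` for a function factored near the centre).

NOT here: the arithmetic inputs (which factor has sign `-1`, which central value vanishes
exactly — `WeierstrassCurve.rootNumber`, `GrossZagier1986_thm_I_7_3`, Artin functional equations),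
and any converse: the functional equation sees the order only modulo `2` (barrier
`Literature.Barriers.BirchSwinnertonDyer.FunctionalEquationSeesOnlyParity`) and no finite numerical
computation certifies the vanishing of a higher derivative (barrier `….NumericalVanishing`).

References: T. Dokchitser, *Notes on the parity conjecture* (2013), §1.1 · B. H. Gross,
D. B. Zagier, Invent. Math. 84 (1986), I.(7.3), p. 231 · J. P. Buhler, B. H. Gross, D. B. Zagier,
Math. Comp. 44 (1985), p. 479 · A. Fröhlich, Invent. Math. 17 (1972) · L. C. Kellock,
V. Dokchitser, Bull. LMS 55 (2023), §3.16 Prop. 3.54, §4 · H. Iwaniec, E. Kowalski, *Analytic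
Number Theory* (2004), §5.
-/

noncomputable section

open Filter

open scoped Topology

namespace Literature.NumberTheory.LFunctions

namespace CentralOrder

/-! ### (M2) A sign `≠ 1` forces a central zero -/

section Sign

variable {Λ : ℂ → ℂ} {w c a : ℂ}

/-- **Forced central zero.** If `Λ(c - s) = w · Λ(s)` for all `s`, `a` is the centre
(`a + a = c`) and `w ≠ 1`, then `Λ(a) = 0`: indeed `Λ(a) = Λ(c - a) = w Λ(a)`. No analyticity is
used. The case `w = -1` is the root-number mechanism (`w(E) = -1 ⇒ L(E,1) = 0`; Dokchitser 2013,
§1.1; for symplectic Artin representations Fröhlich 1972). [cite: Dokchitser2013ParityNotes, §1.1] -/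
theorem apply_center_eq_zero_of_sign_ne_one (hFE : ∀ s, Λ (c - s) = w * Λ s) (ha : a + a = c)
    (hw : w ≠ 1) : Λ a = 0 := by
  have h := hFE a
  rw [show c - a = a from by rw [← ha]; ring] at h
  -- `h : Λ a = w * Λ a`
  have h' : (w - 1) * Λ a = 0 := by linear_combination -h
  rcases mul_eq_zero.mp h' with h1 | h1
  · exact absurd (sub_eq_zero.mp h1) hw
  · exact h1

/-- **Sign `-1` forces a central zero**: `Λ(c - s) = -Λ(s)` for all `s` and `a + a = c` give
`Λ(a) = 0`. [cite: Dokchitser2013ParityNotes, §1.1] -/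
theorem apply_center_eq_zero_of_sign_eq_neg_one (hFE : ∀ s, Λ (c - s) = w * Λ s)
    (ha : a + a = c) (hw : w = -1) : Λ a = 0 :=
  apply_center_eq_zero_of_sign_ne_one hFE ha (by rw [hw]; norm_num)

/-! ### (M1) The sign is `(-1)^{ord}` -/

/-- **Parity constraint (general centre).** If `Λ` is analytic at `a`, satisfies
`Λ(c - s) = w Λ(s)` for all `s` with `a + a = c`, and vanishes to finite order `n` at `a`, then
`w = (-1)ⁿ`. Proof: write `Λ(z) = (z - a)ⁿ g(z)` near `a` with `g(a) ≠ 0`; the functional equation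
reads `(-1)ⁿ (z - a)ⁿ g(c - z) = w (z - a)ⁿ g(z)` on a punctured neighbourhood of `a`; cancel and let
`z → a`. (The centre-`1` case is `Literature.Barriers.BirchSwinnertonDyer.sign_eq_neg_one_pow`,
whose proof is adapted here.) [cite: Dokchitser2013ParityNotes, §1.1] -/
theorem sign_eq_neg_one_pow (hΛ : AnalyticAt ℂ Λ a) (hFE : ∀ s, Λ (c - s) = w * Λ s)
    (ha : a + a = c) {n : ℕ} (hn : analyticOrderAt Λ a = n) : w = (-1) ^ n := by
  obtain ⟨g, hg, hg0, hev⟩ := hΛ.analyticOrderAt_eq_natCast.mp hn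
  have hca : c - a = a := by rw [← ha]; ring
  have hrefl : Tendsto (fun z : ℂ => c - z) (𝓝 a) (𝓝 a) := by
    have hc : Continuous (fun z : ℂ => c - z) := by fun_prop
    simpa only [hca] using hc.tendsto a
  have hev' : ∀ᶠ z in 𝓝 a, Λ (c - z) = ((c - z) - a) ^ n • g (c - z) := hrefl.eventually hev
  have key : ∀ᶠ z in 𝓝[≠] a, (-1) ^ n * g (c - z) = w * g z := by
    have hboth : ∀ᶠ z in 𝓝[≠] a,
        Λ z = (z - a) ^ n • g z ∧ Λ (c - z) = ((c - z) - a) ^ n • g (c - z) :=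
      (hev.and hev').filter_mono nhdsWithin_le_nhds
    have hne : ∀ᶠ z in 𝓝[≠] a, z ≠ a := eventually_mem_nhdsWithin
    filter_upwards [hboth, hne] with z ⟨h1, h1'⟩ hz
    have hFEz := hFE z
    rw [h1', h1] at hFEz
    simp only [smul_eq_mul] at hFEz
    have hz' : (z - a) ^ n ≠ 0 := pow_ne_zero _ (sub_ne_zero.mpr hz)
    have e : (c - z - a : ℂ) = (-1) * (z - a) := by rw [← ha]; ring
    rw [e, mul_pow] at hFEz
    apply mul_left_cancel₀ hz'
    linear_combination hFEz
  have hlim1 : Tendsto (fun z => (-1 : ℂ) ^ n * g (c - z)) (𝓝[≠] a) (𝓝 ((-1) ^ n * g a)) := by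
    have : Tendsto (fun z => g (c - z)) (𝓝 a) (𝓝 (g a)) :=
      hg.continuousAt.tendsto.comp hrefl
    exact (this.const_mul _).mono_left nhdsWithin_le_nhds
  have hlim2 : Tendsto (fun z => w * g z) (𝓝[≠] a) (𝓝 (w * g a)) :=
    (hg.continuousAt.tendsto.const_mul w).mono_left nhdsWithin_le_nhds
  have heq : (-1 : ℂ) ^ n * g a = w * g a := tendsto_nhds_unique (hlim1.congr' key) hlim2
  exact (mul_right_cancel₀ hg0 heq).symm

/-- **The sign is `±1`** unless `Λ` vanishes identically near the centre: under a functional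
equation `Λ(c - s) = w Λ(s)` with `Λ` analytic at the centre `a` and of finite order there,
`w = 1 ∨ w = -1`. [cite: Dokchitser2013ParityNotes, §1.1] -/
theorem sign_eq_one_or_eq_neg_one (hΛ : AnalyticAt ℂ Λ a) (hFE : ∀ s, Λ (c - s) = w * Λ s)
    (ha : a + a = c) (htop : analyticOrderAt Λ a ≠ ⊤) : w = 1 ∨ w = -1 := by
  obtain ⟨n, hn⟩ := ENat.ne_top_iff_exists.mp htop
  rcases Nat.even_or_odd n with h | h
  · exact Or.inl (by rw [sign_eq_neg_one_pow hΛ hFE ha hn.symm, h.neg_one_pow])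
  · exact Or.inr (by rw [sign_eq_neg_one_pow hΛ hFE ha hn.symm, h.neg_one_pow])

/-- **Even order iff sign `+1`.** For `Λ` analytic at the centre `a` of `Λ(c - s) = w Λ(s)`
(`a + a = c`) and not identically zero near `a`: `ord_{s=a} Λ` is even iff `w = 1`.
[cite: Dokchitser2013ParityNotes, §1.1] -/
theorem even_analyticOrderNatAt_iff (hΛ : AnalyticAt ℂ Λ a) (hFE : ∀ s, Λ (c - s) = w * Λ s)
    (ha : a + a = c) (htop : analyticOrderAt Λ a ≠ ⊤) :
    Even (analyticOrderNatAt Λ a) ↔ w = 1 := by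
  have hn : analyticOrderAt Λ a = (analyticOrderNatAt Λ a : ℕ) :=
    (Nat.cast_analyticOrderNatAt htop).symm
  have hw := sign_eq_neg_one_pow hΛ hFE ha hn
  constructor
  · intro h
    rw [hw, h.neg_one_pow]
  · intro h
    by_contra hodd
    rw [Nat.not_even_iff_odd] at hodd
    rw [hodd.neg_one_pow] at hw
    rw [hw] at h
    norm_num at h

/-- **Odd order iff sign `-1`.** For `Λ` analytic at the centre `a` of `Λ(c - s) = w Λ(s)`
(`a + a = c`) and not identically zero near `a`: `ord_{s=a} Λ` is odd iff `w = -1`.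
[cite: Dokchitser2013ParityNotes, §1.1] -/
theorem odd_analyticOrderNatAt_iff (hΛ : AnalyticAt ℂ Λ a) (hFE : ∀ s, Λ (c - s) = w * Λ s)
    (ha : a + a = c) (htop : analyticOrderAt Λ a ≠ ⊤) :
    Odd (analyticOrderNatAt Λ a) ↔ w = -1 := by
  have hn : analyticOrderAt Λ a = (analyticOrderNatAt Λ a : ℕ) :=
    (Nat.cast_analyticOrderNatAt htop).symm
  have hw := sign_eq_neg_one_pow hΛ hFE ha hn
  constructor
  · intro h
    rw [hw, h.neg_one_pow]
  · intro h
    by_contra heven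
    rw [Nat.not_odd_iff_even] at heven
    rw [heven.neg_one_pow] at hw
    rw [hw] at h
    norm_num at h

/-! ### (M4) The parity ladder -/

/-- **The parity ladder.** Let `Λ` be analytic at the centre `a` of `Λ(c - s) = w Λ(s)`
(`a + a = c`). If `ord_{s=a} Λ ≥ n` and `(-1)ⁿ ≠ w`, then `ord_{s=a} Λ ≥ n + 1`: the order cannot
be exactly `n`, by `sign_eq_neg_one_pow`. (If `Λ ≡ 0` near `a` the order is `⊤` and every bound
holds.) [cite: Dokchitser2013ParityNotes, §1.1] -/
theorem succ_le_analyticOrderAt_of_neg_one_pow_ne (hΛ : AnalyticAt ℂ Λ a)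
    (hFE : ∀ s, Λ (c - s) = w * Λ s) (ha : a + a = c) {n : ℕ}
    (hle : (n : ℕ∞) ≤ analyticOrderAt Λ a) (hw : (-1 : ℂ) ^ n ≠ w) :
    ((n + 1 : ℕ) : ℕ∞) ≤ analyticOrderAt Λ a := by
  rcases eq_or_ne (analyticOrderAt Λ a) ⊤ with htop | htop
  · rw [htop]
    exact le_top
  · obtain ⟨m, hm⟩ := ENat.ne_top_iff_exists.mp htop
    rw [← hm] at hle ⊢
    have hnm : n ≤ m := by exact_mod_cast hle
    rcases hnm.eq_or_lt with h | h
    · exact absurd (sign_eq_neg_one_pow hΛ hFE ha (h ▸ hm.symm)).symm hw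
    · exact_mod_cast h

/-- **The parity ladder, in Taylor coefficients.** Let `Λ` be analytic at the centre `a` of
`Λ(c - s) = w Λ(s)` (`a + a = c`). If `Λ^{(i)}(a) = 0` for all `i < n` and `(-1)ⁿ ≠ w`, then also
`Λ^{(n)}(a) = 0` (Mathlib `iteratedDeriv`). [cite: Dokchitser2013ParityNotes, §1.1] -/
theorem iteratedDeriv_eq_zero_of_neg_one_pow_ne (hΛ : AnalyticAt ℂ Λ a)
    (hFE : ∀ s, Λ (c - s) = w * Λ s) (ha : a + a = c) {n : ℕ}
    (hlow : ∀ i < n, iteratedDeriv i Λ a = 0) (hw : (-1 : ℂ) ^ n ≠ w) :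
    iteratedDeriv n Λ a = 0 := by
  have hle : (n : ℕ∞) ≤ analyticOrderAt Λ a :=
    (natCast_le_analyticOrderAt_iff_iteratedDeriv_eq_zero hΛ).mpr hlow
  have hsucc := succ_le_analyticOrderAt_of_neg_one_pow_ne hΛ hFE ha hle hw
  exact (natCast_le_analyticOrderAt_iff_iteratedDeriv_eq_zero hΛ).mp hsucc n (Nat.lt_succ_self n)

/-- **Sign `-1` forces a positive order**: for `Λ` analytic at the centre `a` of
`Λ(c - s) = -Λ(s)` (`a + a = c`), `1 ≤ ord_{s=a} Λ` (rung `0 → 1` of the ladder; equivalently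
`Λ(a) = 0`, `apply_center_eq_zero_of_sign_eq_neg_one`). [cite: Dokchitser2013ParityNotes, §1.1] -/
theorem one_le_analyticOrderAt_of_sign_eq_neg_one (hΛ : AnalyticAt ℂ Λ a)
    (hFE : ∀ s, Λ (c - s) = w * Λ s) (ha : a + a = c) (hw : w = -1) :
    (1 : ℕ∞) ≤ analyticOrderAt Λ a := by
  have h := succ_le_analyticOrderAt_of_neg_one_pow_ne hΛ hFE ha (n := 0) (by simp)
    (by rw [hw]; norm_num)
  simpa using h

/-- **Rung `1 → 2`**: sign `+1` and a central zero force `ord_{s=a} Λ ≥ 2` (the shape of the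
certificate for `389a`: `w(E) = +1` and `L(E,1) = 0` exactly, by modular symbols; Cremona,
*Algorithms for Modular Elliptic Curves*, §2.13). [cite: Dokchitser2013ParityNotes, §1.1] -/
theorem two_le_analyticOrderAt (hΛ : AnalyticAt ℂ Λ a) (hFE : ∀ s, Λ (c - s) = w * Λ s)
    (ha : a + a = c) (hw : w = 1) (h0 : Λ a = 0) : (2 : ℕ∞) ≤ analyticOrderAt Λ a := by
  have h1 : ((1 : ℕ) : ℕ∞) ≤ analyticOrderAt Λ a := by
    rw [natCast_le_analyticOrderAt_iff_iteratedDeriv_eq_zero hΛ]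
    intro i hi
    have hi0 : i = 0 := by omega
    subst hi0
    simpa using h0
  have h := succ_le_analyticOrderAt_of_neg_one_pow_ne hΛ hFE ha h1 (by rw [hw]; norm_num)
  simpa using h

/-- **Rung `2 → 3`**: sign `-1` and a vanishing central DERIVATIVE force `ord_{s=a} Λ ≥ 3` — the
shape of the Gross–Zagier certificate for `5077a` (`w(E) = -1`; `L'(E,1) = 0` exactly because the
Heegner point is torsion; "Since `L(s)` has odd order, we have `ord_{s=1} L(s) ≥ 3`",
Buhler–Gross–Zagier 1985, p. 479; Gross–Zagier 1986, p. 231). [cite: GrossZagierInvent1986, I.(7.3) and p. 231]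
[cite: BuhlerGrossZagier1985, p. 479] -/
theorem three_le_analyticOrderAt (hΛ : AnalyticAt ℂ Λ a) (hFE : ∀ s, Λ (c - s) = w * Λ s)
    (ha : a + a = c) (hw : w = -1) (h1 : deriv Λ a = 0) : (3 : ℕ∞) ≤ analyticOrderAt Λ a := by
  have h0 : Λ a = 0 := apply_center_eq_zero_of_sign_eq_neg_one hFE ha hw
  have h2 : ((2 : ℕ) : ℕ∞) ≤ analyticOrderAt Λ a := by
    rw [natCast_le_analyticOrderAt_iff_iteratedDeriv_eq_zero hΛ]
    intro i hi
    interval_cases i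
    · simpa using h0
    · simpa using h1
  have h := succ_le_analyticOrderAt_of_neg_one_pow_ne hΛ hFE ha h2 (by rw [hw]; norm_num)
  simpa using h

end Sign

/-! ### (M3) Multiplicity: orders add over finite products -/

section Product

variable {ι : Type*} {f : ι → ℂ → ℂ} {z₀ : ℂ}

/-- **Orders of vanishing add over a finite product**: if every `f i` (`i ∈ s`) is analytic at
`z₀`, then `ord_{z₀} ∏_{i ∈ s} f i = ∑_{i ∈ s} ord_{z₀} (f i)` in `ℕ∞` (Mathlib's binary
`analyticOrderAt_mul`, iterated) — zeros counted with multiplicity add under products, the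
logarithmic-derivative bookkeeping `f'/f = ∑ᵢ nᵢ/(z - zᵢ) + φ` of the argument principle (Conway,
*Functions of One Complex Variable I*, IV.3.1 (multiplicity of a zero) and V.3 (Argument
Principle)). [cite: Conway1978, IV.3.1 and V.3.4] -/
theorem analyticOrderAt_finset_prod (s : Finset ι) (hf : ∀ i ∈ s, AnalyticAt ℂ (f i) z₀) :
    analyticOrderAt (∏ i ∈ s, f i) z₀ = ∑ i ∈ s, analyticOrderAt (f i) z₀ := by
  classical
  induction s using Finset.induction_on with
  | empty =>
    simp only [Finset.prod_empty, Finset.sum_empty]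
    exact analyticOrderAt_eq_zero.mpr (Or.inr one_ne_zero)
  | insert i s hi ih =>
    rw [Finset.prod_insert hi, Finset.sum_insert hi,
      analyticOrderAt_mul (hf i (Finset.mem_insert_self i s))
        (Finset.analyticAt_prod s fun j hj => hf j (Finset.mem_insert_of_mem hj)),
      ih fun j hj => hf j (Finset.mem_insert_of_mem hj)]

/-- **Orders of vanishing add over a finite product with multiplicities**: if every `f i`
(`i ∈ s`) is analytic at `z₀`, then `ord_{z₀} ∏_{i ∈ s} (f i)^{m i} = ∑_{i ∈ s} m i • ord_{z₀} (f i)`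
in `ℕ∞` — the mechanism of the Artin factorisation `ζ_L(s) = ∏_ρ L(ρ, s)^{dim ρ}` and of
`L(E/K, s) = L(E, s) L(E^{(d_K)}, s)` (tree: `analyticRankEK_eq_add_of`); multiplicities of zeros
add under products (Conway, IV.3.1 and V.3, Argument Principle). [cite: Conway1978, IV.3.1 and V.3.4] -/
theorem analyticOrderAt_finset_prod_pow (s : Finset ι) (m : ι → ℕ)
    (hf : ∀ i ∈ s, AnalyticAt ℂ (f i) z₀) :
    analyticOrderAt (∏ i ∈ s, f i ^ m i) z₀ = ∑ i ∈ s, m i • analyticOrderAt (f i) z₀ := by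
  rw [analyticOrderAt_finset_prod s fun i hi => (hf i hi).pow (m i)]
  refine Finset.sum_congr rfl fun i hi => ?_
  exact analyticOrderAt_pow (hf i hi) (m i)

/-- **Every vanishing factor contributes its full multiplicity.** If every `f i` (`i ∈ s`) is
analytic at `z₀` and `f i z₀ = 0` for all `i` in a sub-family `S ⊆ s`, then
`∑_{i ∈ S} m i ≤ ord_{z₀} ∏_{i ∈ s} (f i)^{m i}` — the counting step of Kellock–Dokchitser 2023,
§3.16, proof of Prop. 3.54 ("`L(E/F, s) = ∏_ρ L(E, ρ, s)^{dim ρ}` … hence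
`ord_{s=1} L(E/F, s) ≥ …`"). [cite: KellockDokchitser2023, §3.16 Prop. 3.54 (proof)] -/
theorem sum_le_analyticOrderAt_finset_prod_pow (s : Finset ι) (m : ι → ℕ)
    (hf : ∀ i ∈ s, AnalyticAt ℂ (f i) z₀) {S : Finset ι} (hS : S ⊆ s)
    (h0 : ∀ i ∈ S, f i z₀ = 0) :
    ((∑ i ∈ S, m i : ℕ) : ℕ∞) ≤ analyticOrderAt (∏ i ∈ s, f i ^ m i) z₀ := by
  rw [analyticOrderAt_finset_prod_pow s m hf, Nat.cast_sum]
  calc ∑ i ∈ S, ((m i : ℕ) : ℕ∞)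
      ≤ ∑ i ∈ S, m i • analyticOrderAt (f i) z₀ := by
        refine Finset.sum_le_sum fun i hi => ?_
        have h1 : (1 : ℕ∞) ≤ analyticOrderAt (f i) z₀ := by
          rw [Order.one_le_iff_ne_zero, analyticOrderAt_ne_zero]
          exact ⟨hf i (hS hi), h0 i hi⟩
        calc ((m i : ℕ) : ℕ∞) = m i • (1 : ℕ∞) := by simp
          _ ≤ m i • analyticOrderAt (f i) z₀ := nsmul_le_nsmul_right h1 (m i)
    _ ≤ ∑ i ∈ s, m i • analyticOrderAt (f i) z₀ :=
        Finset.sum_le_sum_of_subset_of_nonneg hS fun _ _ _ => zero_le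

/-- **A further analytic factor never lowers the order**: for `A`, `P` analytic at `z₀`,
`ord_{z₀} P ≤ ord_{z₀} (A · P)` (e.g. `ζ_L = A · ∏ L(ρᵢ)^{mᵢ}` with `A` the product of the
remaining, possibly non-vanishing, factors). Private plumbing helper. [folklore] -/
private theorem analyticOrderAt_le_mul_left {A P : ℂ → ℂ} (hA : AnalyticAt ℂ A z₀)
    (hP : AnalyticAt ℂ P z₀) : analyticOrderAt P z₀ ≤ analyticOrderAt (A * P) z₀ := by
  rw [analyticOrderAt_mul hA hP]
  exact le_add_self

end Product

/-! ### (M1 + M3) Signed factors force their multiplicities -/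

section SignedProduct

variable {ι : Type*} {f : ι → ℂ → ℂ} {w : ι → ℂ} {c a : ℂ}

/-- **Signed factors force their multiplicities.** Let `f i` (`i ∈ s`) be analytic at `a`, and
let the factors `f i`, `i ∈ S ⊆ s`, satisfy functional equations `f i (c - z) = -f i z` of sign
`-1` with centre `a` (`a + a = c`). Then each of them vanishes at `a`, so
`∑_{i ∈ S} m i ≤ ord_{s=a} ∏_{i ∈ s} (f i)^{m i}`. Instances: two non-isomorphic symplectic Artin
constituents of dimension `2` with root number `-1` in `ζ_L = ∏ L(ρ)^{dim ρ}` force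
`ord_{s=1/2} ζ_L ≥ 4` (Fröhlich 1972: quaternion fields); `n` self-dual twists of sign `-1` in
`L(E/F, s)`, `Gal(F/ℚ) = D_{2n}`, force `ord ≥ n` (Kellock–Dokchitser 2023, Prop. 3.54).
[cite: KellockDokchitser2023, §3.16 Prop. 3.54] [cite: Frohlich1972, Introduction] -/
theorem sum_le_analyticOrderAt_finset_prod_pow_of_sign (s : Finset ι) (m : ι → ℕ)
    (hf : ∀ i ∈ s, AnalyticAt ℂ (f i) a) {S : Finset ι} (hS : S ⊆ s)
    (hFE : ∀ i ∈ S, ∃ w : ℂ, w ≠ 1 ∧ ∀ z, f i (c - z) = w * f i z) (ha : a + a = c) :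
    ((∑ i ∈ S, m i : ℕ) : ℕ∞) ≤ analyticOrderAt (∏ i ∈ s, f i ^ m i) a := by
  refine sum_le_analyticOrderAt_finset_prod_pow s m hf hS ?_
  intro i hi
  obtain ⟨w, hw, hFEi⟩ := hFE i hi
  exact apply_center_eq_zero_of_sign_ne_one hFEi ha hw

/-- **Signed factors force their multiplicities, for a function given by a factorisation near
the centre.** If `Z = A · ∏_{i ∈ s} (f i)^{m i}` on a neighbourhood of `a` with `A` and all `f i`
analytic at `a`, and the factors `f i`, `i ∈ S ⊆ s`, satisfy functional equations of sign `≠ 1`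
with centre `a` (`a + a = c`), then `∑_{i ∈ S} m i ≤ ord_{s=a} Z` — the consumable shape for a
Dedekind zeta function factored into Artin `L`-functions (`A` = the product of the constituents
about which nothing is claimed). [cite: KellockDokchitser2023, §3.16 Prop. 3.54]
[cite: Frohlich1972, Introduction] -/
theorem sum_le_analyticOrderAt_of_eventuallyEq_mul_finset_prod_pow {Z A : ℂ → ℂ} (s : Finset ι)
    (m : ι → ℕ) (hA : AnalyticAt ℂ A a) (hf : ∀ i ∈ s, AnalyticAt ℂ (f i) a)
    (hZ : Z =ᶠ[𝓝 a] A * ∏ i ∈ s, f i ^ m i) {S : Finset ι} (hS : S ⊆ s)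
    (hFE : ∀ i ∈ S, ∃ w : ℂ, w ≠ 1 ∧ ∀ z, f i (c - z) = w * f i z) (ha : a + a = c) :
    ((∑ i ∈ S, m i : ℕ) : ℕ∞) ≤ analyticOrderAt Z a := by
  rw [analyticOrderAt_congr hZ]
  have hP : AnalyticAt ℂ (∏ i ∈ s, f i ^ m i) a :=
    Finset.analyticAt_prod s fun i hi => (hf i hi).pow (m i)
  exact (sum_le_analyticOrderAt_finset_prod_pow_of_sign s m hf hS hFE ha).trans
    (analyticOrderAt_le_mul_left hA hP)

end SignedProduct

end CentralOrder

end Literature.NumberTheory.LFunctions
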